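import Summits.AtomisticToContinuum.Crystallization.Theorems.FrustratedLawDichotomyCellTriples

/-!
# List-backed label sets and search-tree class tables for cell K-files

Frame file (R) of the residual-cell programme for `AperiodicFrustratedLawGap` (crux `FrustratedLawDichotomy`), companion of
(268) `CellTriples` and (285) `CellSymmZ3`.  MEASURED (lens-5 g113, LABELS-SCALE): a literal `Finset` of F1's 14 065 integer-triple
labels cannot be elaborated (the `{…}` insert chain is quadratic: 729 labels take 79 s, 1 331 do not elaborate), whereas a
KERNEL-ENUMERATED list — a filtered integer box — is enumerated, filtered and folded in seconds.  This file supplies the generic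
plumbing so that a K-file never evaluates a `Finset`:

* §1 the integer box `boxL R` (all triples with `|mᵢ| ≤ R`, membership by PREDICATE `mem_boxL`, `Nodup` proved structurally) and the
  label list `labL R adm := (boxL R).filter adm` (`mem_labL`, `nodup_labL`); the cell's label set is `M := (labL R adm).toFinset`,
  never unfolded;
* §2 the bridges from `Finset` statements over `L.toFinset` to list computations: `∀`, `Σ` (`sum_toFinset_eq`), `filter`, `erase`,
  the near lists `ballL` of (261) (`ballL_toFinset`), and ★ the certificate bridge `cast_fold_le_sum`: a decided rational fold
  `(L.map g).sum` bounds the real label sum `Σ_{m ∈ L.toFinset} f m` from below once `g m ≤ f m` label-wise;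
* §3 an O(n) `Nodup` certificate for ANY list (census-supplied representative / interior lists): a strictly increasing integer key
  along the list (`chainKey`, structural `Bool` recursion, one `decide`);
* §4 ★ binary search trees `BT α` keyed by `ℤ` (the integer class key `qZ (TZᵀTZ)` of (285)) carrying class data `α`: `find` in
  O(depth), `all p` checked ONCE over the tree, and the soundness lemmas `find_sound` / `getD_sound` transporting a class fact decided
  on the 899 leaves to each of the 14 065 labels through the decided hit-check `(t.find (q m)).isSome` (≈ 1.7 ms per label measured).

All statements are label-generic; nothing here is specific to a template.  [folklore]
-/

namespace Summit.AtomisticToContinuum.Crystallization.Theorems.FrustratedLawDichotomyCellLabelList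

open scoped BigOperators
open Summit.AtomisticToContinuum.Crystallization.Theorems.FrustratedLawDichotomyCellClasses (ballL)
open Summit.AtomisticToContinuum.Crystallization.Theorems.FrustratedLawDichotomyCellTriples

/-! ### §1 The integer box and list-backed label sets -/

/-- the integer range `[-R, R]` as a list (increasing). -/
def rng (R : ℕ) : List ℤ := (List.range (2 * R + 1)).map fun n : ℕ => (n : ℤ) - R

/-- membership in the range is the predicate `-R ≤ a ≤ R`. -/
theorem mem_rng {R : ℕ} {a : ℤ} : a ∈ rng R ↔ -(R : ℤ) ≤ a ∧ a ≤ R := by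
  unfold rng
  simp only [List.mem_map, List.mem_range]
  constructor
  · rintro ⟨n, hn, rfl⟩
    omega
  · rintro ⟨h1, h2⟩
    refine ⟨(a + R).toNat, by omega, by omega⟩

/-- the range has no duplicates. -/
theorem nodup_rng (R : ℕ) : (rng R).Nodup := by
  unfold rng
  refine (List.nodup_range).map ?_
  intro a b h
  have : (a : ℤ) - R = (b : ℤ) - R := h
  exact_mod_cast sub_left_injective this

/-- the integer box: all triples `(i, j, k)` with `|i|, |j|, |k| ≤ R`, enumerated lexicographically. -/
def boxL (R : ℕ) : List (ℤ × ℤ × ℤ) :=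
  (rng R).flatMap fun i => (rng R).flatMap fun j => (rng R).map fun k => (i, j, k)

/-- ★ membership in the box is a PREDICATE (no list search): this is how a K-file proves `act x ∈ M` for a computed label. -/
theorem mem_boxL {R : ℕ} {m : ℤ × ℤ × ℤ} :
    m ∈ boxL R ↔ (-(R : ℤ) ≤ m.1 ∧ m.1 ≤ R) ∧ (-(R : ℤ) ≤ m.2.1 ∧ m.2.1 ≤ R) ∧ (-(R : ℤ) ≤ m.2.2 ∧ m.2.2 ≤ R) := by
  obtain ⟨i, j, k⟩ := m
  unfold boxL
  simp only [List.mem_flatMap, List.mem_map, Prod.mk.injEq]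
  constructor
  · rintro ⟨i', hi, j', hj, k', hk, rfl, rfl, rfl⟩
    exact ⟨mem_rng.1 hi, mem_rng.1 hj, mem_rng.1 hk⟩
  · rintro ⟨hi, hj, hk⟩
    exact ⟨i, mem_rng.2 hi, j, mem_rng.2 hj, k, mem_rng.2 hk, rfl, rfl, rfl⟩

/-- a `flatMap` of duplicate-free, pairwise-disjoint lists over a duplicate-free list is duplicate-free. -/
theorem nodup_flatMap_of {α β : Type*} {l : List α} (hl : l.Nodup) {f : α → List β} (hf : ∀ a ∈ l, (f a).Nodup)
    (hd : ∀ a ∈ l, ∀ b ∈ l, a ≠ b → ∀ x, x ∈ f a → x ∈ f b → False) : (l.flatMap f).Nodup := by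
  induction l with
  | nil => simp
  | cons a t ih =>
    rw [List.flatMap_cons, List.nodup_append]
    refine ⟨hf a (by simp), ih (List.Nodup.of_cons hl) (fun b hb => hf b (by simp [hb]))
      (fun b hb c hc => hd b (by simp [hb]) c (by simp [hc])), ?_⟩
    intro x hx y hy hxy
    subst hxy
    rw [List.mem_flatMap] at hy
    obtain ⟨b, hb, hxb⟩ := hy
    have hab : a ≠ b := by
      rintro rfl
      exact (List.nodup_cons.1 hl).1 hb
    exact hd a (by simp) b (by simp [hb]) hab x hx hxb

/-- the box has no duplicates (structural — no kernel cost). -/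
theorem nodup_boxL (R : ℕ) : (boxL R).Nodup := by
  unfold boxL
  refine nodup_flatMap_of (nodup_rng R) (fun i _ => ?_) (fun i _ i' _ hii' x hx hx' => ?_)
  · refine nodup_flatMap_of (nodup_rng R) (fun j _ => (nodup_rng R).map fun k k' h => by simpa using h)
      (fun j _ j' _ hjj' x hx hx' => ?_)
    simp only [List.mem_map] at hx hx'
    obtain ⟨k, -, rfl⟩ := hx
    obtain ⟨k', -, h⟩ := hx'
    simp only [Prod.mk.injEq] at h
    exact hjj' h.2.1.symm
  · simp only [List.mem_flatMap, List.mem_map] at hx hx'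
    obtain ⟨j, -, k, -, rfl⟩ := hx
    obtain ⟨j', -, k', -, h⟩ := hx'
    simp only [Prod.mk.injEq] at h
    exact hii' h.1.symm

/-- ★ the LABEL LIST of a cell: the box filtered by a decidable admissibility test (parity, template-scalar window, census
drops …). -/
def labL (R : ℕ) (adm : ℤ × ℤ × ℤ → Bool) : List (ℤ × ℤ × ℤ) := (boxL R).filter adm

/-- membership in the label list is a predicate. -/
theorem mem_labL {R : ℕ} {adm : ℤ × ℤ × ℤ → Bool} {m : ℤ × ℤ × ℤ} :
    m ∈ labL R adm ↔
      ((-(R : ℤ) ≤ m.1 ∧ m.1 ≤ R) ∧ (-(R : ℤ) ≤ m.2.1 ∧ m.2.1 ≤ R) ∧ (-(R : ℤ) ≤ m.2.2 ∧ m.2.2 ≤ R))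
        ∧ adm m = true := by
  unfold labL
  rw [List.mem_filter, mem_boxL]

/-- the label list has no duplicates. -/
theorem nodup_labL (R : ℕ) (adm : ℤ × ℤ × ℤ → Bool) : (labL R adm).Nodup := (nodup_boxL R).filter _

/-- membership in the cell's label SET `(labL R adm).toFinset` is the same predicate. -/
theorem mem_toFinset_labL {R : ℕ} {adm : ℤ × ℤ × ℤ → Bool} {m : ℤ × ℤ × ℤ} :
    m ∈ (labL R adm).toFinset ↔
      ((-(R : ℤ) ≤ m.1 ∧ m.1 ≤ R) ∧ (-(R : ℤ) ≤ m.2.1 ∧ m.2.1 ≤ R) ∧ (-(R : ℤ) ≤ m.2.2 ∧ m.2.2 ≤ R))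
        ∧ adm m = true := by
  rw [List.mem_toFinset, mem_labL]

/-! ### §2 From `Finset` statements over `L.toFinset` to list computations -/

section Bridges

variable {ι : Type*} [DecidableEq ι]

/-- `∀` over the label set is `∀` over the list (then `decide` runs a single pass). -/
theorem forall_toFinset {L : List ι} {P : ι → Prop} : (∀ m ∈ L.toFinset, P m) ↔ ∀ m ∈ L, P m := by
  simp only [List.mem_toFinset]

/-- `Σ` over the label set is the list fold (for a duplicate-free list). -/
theorem sum_toFinset_eq {L : List ι} (hL : L.Nodup) (f : ι → ℝ) : ∑ m ∈ L.toFinset, f m = (L.map f).sum := by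
  induction L with
  | nil => simp
  | cons a t ih =>
    rw [List.toFinset_cons, Finset.sum_insert (by simpa using (List.nodup_cons.1 hL).1), List.map_cons, List.sum_cons,
      ih (List.Nodup.of_cons hL)]

/-- `filter` of the label set is the filtered list. -/
theorem filter_toFinset (L : List ι) (p : ι → Prop) [DecidablePred p] :
    L.toFinset.filter p = (L.filter fun x => decide (p x)).toFinset := by
  ext x
  simp [List.mem_toFinset]

/-- `erase` of the label set is a filtered list. -/
theorem erase_toFinset (L : List ι) (a : ι) : L.toFinset.erase a = (L.filter fun x => decide (x ≠ a)).toFinset := by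
  ext x
  simp [List.mem_toFinset, and_comm]

omit [DecidableEq ι] in
/-- a filtered duplicate-free list is duplicate-free (restated for K-files). -/
theorem nodup_filter' {L : List ι} (hL : L.Nodup) (p : ι → Bool) : (L.filter p).Nodup := hL.filter _

omit [DecidableEq ι] in
/-- cast of a rational list fold. -/
theorem cast_list_sum (L : List ι) (g : ι → ℚ) : (((L.map g).sum : ℚ) : ℝ) = (L.map fun m => (g m : ℝ)).sum := by
  induction L with
  | nil => simp
  | cons a t ih => simp [List.map_cons, List.sum_cons, ih]

omit [DecidableEq ι] in
/-- monotonicity of list folds. -/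
theorem list_sum_le_sum {L : List ι} {f g : ι → ℝ} (h : ∀ m ∈ L, g m ≤ f m) : (L.map g).sum ≤ (L.map f).sum := by
  induction L with
  | nil => simp
  | cons a t ih =>
    simp only [List.map_cons, List.sum_cons]
    exact add_le_add (h a (by simp)) (ih fun m hm => h m (by simp [hm]))

/-- ★ THE CERTIFICATE BRIDGE: a decided rational fold over the label list bounds the real label sum from below, given the
label-wise comparison `g m ≤ f m` (in a K-file: `g m` = the class READING stored at the search-tree leaf of `q m`, `f m` = the real
host / debit / NASH number of the label; the comparison is the class fact transported by `getD_sound`). -/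
theorem cast_fold_le_sum {L : List ι} (hL : L.Nodup) {f : ι → ℝ} {g : ι → ℚ} (h : ∀ m ∈ L, (g m : ℝ) ≤ f m) :
    (((L.map g).sum : ℚ) : ℝ) ≤ ∑ m ∈ L.toFinset, f m := by
  rw [sum_toFinset_eq hL, cast_list_sum]
  exact list_sum_le_sum h

/-- upper-bound form. -/
theorem sum_le_cast_fold {L : List ι} (hL : L.Nodup) {f : ι → ℝ} {g : ι → ℚ} (h : ∀ m ∈ L, f m ≤ (g m : ℝ)) :
    ∑ m ∈ L.toFinset, f m ≤ (((L.map g).sum : ℚ) : ℝ) := by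
  rw [sum_toFinset_eq hL, cast_list_sum]
  exact list_sum_le_sum h

end Bridges

/-- the near lists of (261) over a list-backed label set are filtered lists: `ballL` by the decided integer test of (268). -/
theorem ballL_toFinset (L : List (ℤ × ℤ × ℤ)) (ℓ : ℤ) (c : ℤ × ℤ × ℤ) :
    ballL L.toFinset zT ℓ c = (L.filter fun x => decide (sqT (subT x c) < ℓ)).toFinset := by
  rw [ballL_zT_eq, filter_toFinset]

/-! ### §3 An O(n) `Nodup` certificate for any list: a strictly increasing integer key -/

section Chain

variable {ι : Type*}

/-- `true` iff `key` is strictly increasing along the list (structural recursion; one `decide` pass). -/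
def chainKey (key : ι → ℤ) : List ι → Bool
  | a :: b :: t => decide (key a < key b) && chainKey key (b :: t)
  | _ => true

/-- a strictly increasing key bounds every later key. -/
theorem chainKey_cons {key : ι → ℤ} : ∀ {a : ι} {l : List ι}, chainKey key (a :: l) = true → ∀ x ∈ l, key a < key x
  | a, [], _ => by simp
  | a, b :: t, h => by
    simp only [chainKey, Bool.and_eq_true, decide_eq_true_eq] at h
    intro x hx
    rcases List.mem_cons.1 hx with rfl | hx
    · exact h.1
    · exact h.1.trans (chainKey_cons h.2 x hx)

/-- ★ a list with a strictly increasing integer key has no duplicates (census-supplied lists: representatives, interior labels). -/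
theorem nodup_of_chainKey (key : ι → ℤ) : ∀ {l : List ι}, chainKey key l = true → l.Nodup
  | [], _ => List.nodup_nil
  | a :: t, h => by
    refine List.nodup_cons.2 ⟨fun ha => lt_irrefl _ (chainKey_cons h a ha), nodup_of_chainKey key ?_⟩
    cases t with
    | nil => rfl
    | cons b t' =>
      simp only [chainKey, Bool.and_eq_true, decide_eq_true_eq] at h
      exact h.2

end Chain

/-! ### §4 Binary search trees keyed by `ℤ` carrying class data -/

/-- a binary search tree with integer keys and values in `α` (a K-file's class table: key = the integer template scalar of the
class, value = the class readings). -/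
inductive BT (α : Type) where
  | nil : BT α
  | node : BT α → ℤ → α → BT α → BT α

namespace BT

variable {α : Type}

/-- O(depth) lookup. -/
def find (q : ℤ) : BT α → Option α
  | nil => none
  | node l k v r => if q < k then l.find q else if k < q then r.find q else some v

/-- a property of (key, value) checked at EVERY node (one `decide` over the tree = once per class). -/
def all (p : ℤ → α → Bool) : BT α → Bool
  | nil => true
  | node l k v r => p k v && l.all p && r.all p

/-- ★ SOUNDNESS: if every node satisfies `p` and the lookup of `q` returns `v`, then `p q v` (no search-tree invariant is needed:
`find` only returns a node whose key EQUALS `q`). -/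
theorem find_sound {p : ℤ → α → Bool} {q : ℤ} {v : α} : ∀ {t : BT α}, t.all p = true → t.find q = some v → p q v = true
  | nil, _, h => by simp [find] at h
  | node l k w r, hall, h => by
    simp only [all, Bool.and_eq_true] at hall
    simp only [find] at h
    split_ifs at h with h1 h2
    · exact find_sound hall.1.2 h
    · exact find_sound hall.2 h
    · have hq : q = k := le_antisymm (not_lt.1 h2) (not_lt.1 h1)
      subst hq
      simp only [Option.some.injEq] at h
      subst h
      exact hall.1.1

/-- the `getD` form used to DEFINE per-label numbers: `val m := (t.find (q m)).getD d`. -/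
theorem getD_sound {p : ℤ → α → Bool} {q : ℤ} {t : BT α} (hall : t.all p = true) (hhit : (t.find q).isSome = true) (d : α) :
    p q ((t.find q).getD d) = true := by
  cases h : t.find q with
  | none => simp [h] at hhit
  | some v => simpa using find_sound hall h

/-- transport of a class fact to every label of a list through the decided hit-check. -/
theorem forall_getD_sound {ι : Type*} {p : ℤ → α → Bool} {t : BT α} (hall : t.all p = true) {L : List ι} (q : ι → ℤ)
    (hhit : ∀ m ∈ L, (t.find (q m)).isSome = true) (d : α) : ∀ m ∈ L, p (q m) ((t.find (q m)).getD d) = true :=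
  fun m hm => getD_sound hall (hhit m hm) d

end BT

end Summit.AtomisticToContinuum.Crystallization.Theorems.FrustratedLawDichotomyCellLabelList
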